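import Summits.BirchSwinnertonDyer.BirchSwinnertonDyer.Theses.BiquadraticEisensteinDescent
import Literature.NumberTheory.EllipticCurves.BSDSelmerCMPConverse
import Literature.NumberTheory.EllipticCurves.BSDSelmerSmithTwoSelmerRankLaws
import Literature.NumberTheory.EllipticCurves.GlobalMinimalModel

/-!
# Sketch — crux-ideate seat 2 (g11), `stmt-BirchSwinnertonDyer-21381` `HeegnerTwistCouplingInSupply`

First-lemma signatures for the crux idea card `least-prime-selmer-seed`
(the rank-lowering prime IS the twist; size does the class number; the residual is a
least-prime-in-a-Chebotarev-class bound).  Planner sketch only: nothing here is filed as a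
statement item, no skeleton is registered (W-79), nothing is proved except two lines of
arithmetic glue.  BSD is not proved by this.

* `SmallSelmerZeroSeed` — TRANSFER TARGET `C⁺_seed`: on every TYPE-S corner pair `(W, p)`
  (`W[2]` irreducible) there is a Heegner field `K' = ℚ(√d)` for `N_W` with `h(K') < p` and
  `r_2(W^d) = 0` (Smith's `2`-Selmer rank).  Both conjuncts are decidable per instance; no
  `L`-function occurs.  `C⁺_seed ⇒ crux|type-S` via Burungale–Tian's rank-zero `2`-converse.
* `PrimeSeedBelow B` — the Chebotarev-level form: the seed is `d = -q` with `q` a PRIME below a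
  bound `B W p` (the card takes `B = p² / (4 log² p)`-shaped bounds so that `h(-q) < p` is automatic
  by `h(-q) < √q log q / π`-type bounds); under GRH for the Dedekind zeta function of the
  `S₄`-field `ℚ(W[2], ½P)` one may take `B ≍ (dim Sel₂ W + log N_W)²`.
* `not_dvd_of_classNumber_lt` — the size switch in one line.
* `CruxTypeS`, `CruxOfSeed` — the crux restricted to type S and the assembly shape.
-/

open scoped Classical
open Literature.NumberTheory.EllipticCurves

namespace Summit.BirchSwinnertonDyer.BirchSwinnertonDyer.Cruxes.HeegnerTwistCouplingInSupply.LeastPrimeSelmerSeed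

/-- The crux, by name. -/
abbrev Crux : Prop :=
  Summit.BirchSwinnertonDyer.BirchSwinnertonDyer.Theses.BiquadraticEisensteinDescent.HeegnerTwistCouplingInSupply

/-- **TRANSFER TARGET `C⁺_seed`.**  For every TYPE-S corner pair `(W, p)` there is an imaginary
quadratic `K'` of discriminant `d`, `|d| > 4`, Heegner for `N_W`, with CLASS NUMBER BELOW `p` and
`r_2(W^d) = 0`.  Strictly stronger than the crux on type-S corners (given the Burungale–Tian
`2`-converse and `h < p ⇒ p ∤ h`), but both conjuncts are algebraic/decidable and the existence is a
least-prime-in-a-Chebotarev-class statement (see the card). -/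
def SmallSelmerZeroSeed : Prop :=
  ∀ (W : WeierstrassCurve ℚ) [W.IsElliptic] [W.IsGloballyMinimal] (p : ℕ) [Fact p.Prime]
    [NeZero (W.conductorNorm ℤ)],
    W.HasCM → W.HasIrreducibleModPGaloisRep 2 → W.analyticRank = 1 → 5 ≤ p →
    Rank1Residual.CMInert W p → ¬ Rank1Residual.Good W p →
    ∃ (K : Type) (_ : Field K) (_ : NumberField K), IsImaginaryQuadratic K ∧
      4 < (NumberField.discr K).natAbs ∧ SatisfiesHeegnerHypothesis (W.conductorNorm ℤ) K ∧
      NumberField.classNumber K < p ∧ twistSelmerTorsionRank W (NumberField.discr K) = 0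

/-- **Chebotarev-level form.**  The seed is a PRIME discriminant `d = -q` below a bound `B W p`:
`q ≡ 3 (mod 4)` prime, `ℚ(√-q)` Heegner for `N_W`, `q < B W p`, and twisting by `-q` kills the
`2`-Selmer group.  (On a `j = 0` type-S corner the primes that do this are: `q ≡ 7 (mod 8)`,
`q ≡ 2 (mod 3)`, `(-q/ℓ) = 1` for `ℓ ∣ N_W` odd, and `Frob_q` a `4`-cycle on the four halves of the
generator `P` — i.e. the halving quartic of `P` irreducible mod `q`; Mazur–Rubin 2010 §3.)  With
`B W p = p² / (c log² p)` the class number of `ℚ(√-q)` is `< p`, so `PrimeSeedBelow B → SmallSelmerZeroSeed`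
on corners where one prime suffices (`dim Sel₂(W) = 1`). -/
def PrimeSeedBelow (B : WeierstrassCurve ℚ → ℕ → ℕ) : Prop :=
  ∀ (W : WeierstrassCurve ℚ) [W.IsElliptic] [W.IsGloballyMinimal] (p : ℕ) [Fact p.Prime]
    [NeZero (W.conductorNorm ℤ)],
    W.HasCM → W.HasIrreducibleModPGaloisRep 2 → W.analyticRank = 1 → 5 ≤ p →
    Rank1Residual.CMInert W p → ¬ Rank1Residual.Good W p → twistSelmerTorsionRank W 1 = 1 →
    ∃ (q : ℕ) (K : Type) (_ : Field K) (_ : NumberField K), q.Prime ∧ q % 4 = 3 ∧ q < B W p ∧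
      IsImaginaryQuadratic K ∧ NumberField.discr K = -(q : ℤ) ∧
      SatisfiesHeegnerHypothesis (W.conductorNorm ℤ) K ∧ twistSelmerTorsionRank W (-(q : ℤ)) = 0

/-- The size switch: a class number below `p` is prime to `p` (class numbers are positive). -/
theorem not_dvd_of_classNumber_lt {K : Type*} [Field K] [NumberField K] {p : ℕ}
    (h : NumberField.classNumber K < p) : ¬ p ∣ NumberField.classNumber K := by
  intro hdvd
  have hpos : 0 < NumberField.classNumber K := by
    unfold NumberField.classNumber
    exact Fintype.card_pos
  exact absurd (Nat.le_of_dvd hpos hdvd) (not_le.mpr h)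

/-- The crux restricted to TYPE-S curves (`W[2]` irreducible). -/
def CruxTypeS : Prop :=
  ∀ (W : WeierstrassCurve ℚ) [W.IsElliptic] [W.IsGloballyMinimal] (p : ℕ) [Fact p.Prime]
    [NeZero (W.conductorNorm ℤ)], W.HasIrreducibleModPGaloisRep 2 →
    W.HasCM → W.analyticRank = 1 → 5 ≤ p → Rank1Residual.CMInert W p → ¬ Rank1Residual.Good W p →
    (∀ B : ℕ, ∃ (K : Type) (_ : Field K) (_ : NumberField K), IsImaginaryQuadratic K ∧
      B < (NumberField.discr K).natAbs ∧ 4 < (NumberField.discr K).natAbs ∧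
      SatisfiesHeegnerHypothesis (W.conductorNorm ℤ) K ∧ ¬ p ∣ NumberField.classNumber K) →
    ∃ (K : Type) (_ : Field K) (_ : NumberField K), IsImaginaryQuadratic K ∧
      4 < (NumberField.discr K).natAbs ∧ SatisfiesHeegnerHypothesis (W.conductorNorm ℤ) K ∧
      (W.quadraticTwist (NumberField.discr K : ℚ)).entireLFunction 1 ≠ 0 ∧
      ¬ p ∣ NumberField.classNumber K

/-- **Assembly shape** (FIRST LEMMA of the line; to be proved in a crux-plan skeleton, not here):
the seed plus Burungale–Tian's rank-zero `2`-converse for CM curves give the crux on type-S corners.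
Remaining glue, all S-sized: `r_2(W^d) = 0 ⇒ Sel_{2^∞}(W^d)` has corank `0`; `W^d` is CM;
analytic rank `0 ⇒ Λ(W^d, 1) ≠ 0`; `h < p ⇒ p ∤ h` (`not_dvd_of_classNumber_lt`). -/
def CruxOfSeed : Prop :=
  SmallSelmerZeroSeed → burungaleTian_analyticRank_eq_zero_of_selmerCorank_eq_zero_of_hasCM → CruxTypeS

end Summit.BirchSwinnertonDyer.BirchSwinnertonDyer.Cruxes.HeegnerTwistCouplingInSupply.LeastPrimeSelmerSeed
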